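import Summits.Ventures.Crystal3D.Theorems.StickyWulffConstantCoaxialWallLawBarlowWindowFrames
import HarnessLib

/-!
# (D4″-menu) THE FRAME LEMMA under the abstract eighteen-vector neighbour menu
# (crux `CoaxialWallLaw`, stmt-Ventures-19481, line `WallLedgerF`; re-base of `…BarlowWindowFrames` for 𝒰_cx)

HONEST FRAMING. Venture `Summits/Ventures/Crystal3D` (cell `crystal3d-full`), helper `--supports` the crux
`CoaxialWallLaw` (stmt-Ventures-19481, `route-Ventures-StickyWulffConstant`), REGISTERED line `WallLedgerF` (planner
cf-p1, decision (lxii): the non-Barlow coaxial universe of record is the COAXIAL MODULE universe 𝒰_cx).  Rung credit;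
F-C1 not moved; census-free.

`…BarlowWindowFrames` proved the frame lemma on Barlow windows, but its proofs use the stacking only through the
NEIGHBOUR MENU: every occupied unit offset of the reader `q` lies in `D₊ ∪ D₋ = fccSlots ∪ basalMirror '' fccSlots`.
This file re-proves the same statements under exactly that hypothesis,
`hmenu : ∀ x ∈ X, dist q x = 1 → x − q ∈ fccSlots ∨ x − q ∈ basalMirror '' fccSlots`,
so that they apply verbatim to COAXIAL-MODULE windows (19481-p1's `coaxialModule_neighbour_mem`) as well as to Barlow
windows (`barlow_neighbour_mem`):
* `slot_mem_menu`, `frame_of_face_occupied_menu`;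
* **`frame_of_isFull_menu`**, **`frame_of_isTwinReading_menu`**, **`frame_of_isNarrow_menu`**, **`frame_of_isEndMove_menu`**,
  `frame_of_isMoving_menu` — every `v2(A)` reading frame at `q` has `G '' fccSlots = D₊` or `= D₋`.
WHAT THIS IS NOT: not the bridge, not the tail; F-C1 not moved.
-/

noncomputable section

namespace Summit.Ventures.Crystal3D.Theorems

open Summit.Ventures.Crystal3D Finset
open Literature.MathematicalPhysics.StatisticalMechanics (basalMirror)
open scoped InnerProductSpace

section Frame

variable {X : Finset (EuclideanSpace ℝ (Fin 3))} {q : EuclideanSpace ℝ (Fin 3)}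

/-- An occupied `G`-slot of `q` is a vector of `D₊ ∪ D₋`. -/
theorem slot_mem_menu (hmenu : ∀ x ∈ X, dist q x = 1 →
      x - q ∈ fccSlots ∨ x - q ∈ (basalMirror : EuclideanSpace ℝ (Fin 3) → EuclideanSpace ℝ (Fin 3)) '' ↑fccSlots)
    (G : EuclideanSpace ℝ (Fin 3) ≃ₗᵢ[ℝ] EuclideanSpace ℝ (Fin 3))
    {w : EuclideanSpace ℝ (Fin 3)} (hw : w ∈ fccSlots) (hocc : q + G w ∈ X) :
    G w ∈ fccSlots ∨ G w ∈ (basalMirror : EuclideanSpace ℝ (Fin 3) → EuclideanSpace ℝ (Fin 3)) '' ↑fccSlots := by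
  have hd : dist q (q + G w) = 1 := by
    rw [dist_eq_norm, sub_add_cancel_left, norm_neg, LinearIsometryEquiv.norm_map, norm_eq_one_of_mem_fccSlots hw]
  have := hmenu _ hocc hd
  rwa [add_sub_cancel_left] at this

/-- An occupied unit offset of `q` is a neighbour-menu vector. -/
theorem mem_menu_of_occupied (hmenu : ∀ x ∈ X, dist q x = 1 →
      x - q ∈ fccSlots ∨ x - q ∈ (basalMirror : EuclideanSpace ℝ (Fin 3) → EuclideanSpace ℝ (Fin 3)) '' ↑fccSlots)
    {y : EuclideanSpace ℝ (Fin 3)} (hy1 : ‖y‖ = 1) (hocc : q + y ∈ X) :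
    y ∈ fccSlots ∨ y ∈ (basalMirror : EuclideanSpace ℝ (Fin 3) → EuclideanSpace ℝ (Fin 3)) '' ↑fccSlots := by
  have hd : dist q (q + y) = 1 := by rw [dist_eq_norm, sub_add_cancel_left, norm_neg, hy1]
  have := hmenu _ hocc hd
  rwa [add_sub_cancel_left] at this

/-- **Core**: three occupied `G`-slots of `q` forming a `60°` face force `G '' fccSlots = D₊` or `= D₋`. -/
theorem frame_of_face_occupied_menu (hmenu : ∀ x ∈ X, dist q x = 1 →
      x - q ∈ fccSlots ∨ x - q ∈ (basalMirror : EuclideanSpace ℝ (Fin 3) → EuclideanSpace ℝ (Fin 3)) '' ↑fccSlots)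
    (G : EuclideanSpace ℝ (Fin 3) ≃ₗᵢ[ℝ] EuclideanSpace ℝ (Fin 3))
    {a b c : EuclideanSpace ℝ (Fin 3)} (ha : a ∈ fccSlots) (hb : b ∈ fccSlots) (hc : c ∈ fccSlots)
    (hab : ⟪a, b⟫_ℝ = 1 / 2) (hac : ⟪a, c⟫_ℝ = 1 / 2) (hbc : ⟪b, c⟫_ℝ = 1 / 2)
    (hoa : q + G a ∈ X) (hob : q + G b ∈ X) (hoc : q + G c ∈ X) :
    (G : EuclideanSpace ℝ (Fin 3) → EuclideanSpace ℝ (Fin 3)) '' ↑fccSlots = ↑fccSlots ∨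
      (G : EuclideanSpace ℝ (Fin 3) → EuclideanSpace ℝ (Fin 3)) '' ↑fccSlots =
        (basalMirror : EuclideanSpace ℝ (Fin 3) → EuclideanSpace ℝ (Fin 3)) '' ↑fccSlots := by
  have hGab : ⟪G a, G b⟫_ℝ = 1 / 2 := by rw [LinearIsometryEquiv.inner_map_map, hab]
  have hGac : ⟪G a, G c⟫_ℝ = 1 / 2 := by rw [LinearIsometryEquiv.inner_map_map, hac]
  have hGbc : ⟪G b, G c⟫_ℝ = 1 / 2 := by rw [LinearIsometryEquiv.inner_map_map, hbc]
  rcases face_pure_of_neighbourMenu (slot_mem_menu hmenu G ha hoa) (slot_mem_menu hmenu G hb hob)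
    (slot_mem_menu hmenu G hc hoc) hGab hGac hGbc with ⟨h1, h2, h3⟩ | ⟨h1, h2, h3⟩
  · left
    have hrefl : ((LinearIsometryEquiv.refl ℝ (EuclideanSpace ℝ (Fin 3)) :
        EuclideanSpace ℝ (Fin 3) → EuclideanSpace ℝ (Fin 3)) '' ↑fccSlots) = ↑fccSlots := by
      simp
    have key := image_fccSlots_eq_of_triangle G (LinearIsometryEquiv.refl ℝ _) ha hb hc hab hac hbc
      (by rw [hrefl]; exact mem_coe.2 h1) (by rw [hrefl]; exact mem_coe.2 h2) (by rw [hrefl]; exact mem_coe.2 h3)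
    rwa [hrefl] at key
  · right
    exact image_fccSlots_eq_of_triangle G basalMirror ha hb hc hab hac hbc h1 h2 h3

/-- **FULL readings**: `IsFull X G q` forces `G '' fccSlots ∈ {D₊, D₋}`. -/
theorem frame_of_isFull_menu (hmenu : ∀ x ∈ X, dist q x = 1 →
      x - q ∈ fccSlots ∨ x - q ∈ (basalMirror : EuclideanSpace ℝ (Fin 3) → EuclideanSpace ℝ (Fin 3)) '' ↑fccSlots)
    {G : EuclideanSpace ℝ (Fin 3) ≃ₗᵢ[ℝ] EuclideanSpace ℝ (Fin 3)} (h : IsFull X G q) :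
    (G : EuclideanSpace ℝ (Fin 3) → EuclideanSpace ℝ (Fin 3)) '' ↑fccSlots = ↑fccSlots ∨
      (G : EuclideanSpace ℝ (Fin 3) → EuclideanSpace ℝ (Fin 3)) '' ↑fccSlots =
        (basalMirror : EuclideanSpace ℝ (Fin 3) → EuclideanSpace ℝ (Fin 3)) '' ↑fccSlots := by
  obtain ⟨a, ha, b, hb, c, hc, hab, hac, hbc⟩ := exists_model_face
  exact frame_of_face_occupied_menu hmenu G ha hb hc hab hac hbc (h a ha) (h b hb) (h c hc)

/-- **TWIN-DOZEN readings**: `IsTwinReading X G m q` forces `G '' fccSlots ∈ {D₊, D₋}` (the lower face is occupied). -/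
theorem frame_of_isTwinReading_menu (hmenu : ∀ x ∈ X, dist q x = 1 →
      x - q ∈ fccSlots ∨ x - q ∈ (basalMirror : EuclideanSpace ℝ (Fin 3) → EuclideanSpace ℝ (Fin 3)) '' ↑fccSlots)
    {G : EuclideanSpace ℝ (Fin 3) ≃ₗᵢ[ℝ] EuclideanSpace ℝ (Fin 3)}
    {m : EuclideanSpace ℝ (Fin 3)} (h : IsTwinReading X G m q) :
    (G : EuclideanSpace ℝ (Fin 3) → EuclideanSpace ℝ (Fin 3)) '' ↑fccSlots = ↑fccSlots ∨
      (G : EuclideanSpace ℝ (Fin 3) → EuclideanSpace ℝ (Fin 3)) '' ↑fccSlots =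
        (basalMirror : EuclideanSpace ℝ (Fin 3) → EuclideanSpace ℝ (Fin 3)) '' ↑fccSlots := by
  obtain ⟨⟨hm, hmn⟩, hown, -, -⟩ := h
  have hm' : ‖-m‖ = 1 := by rw [norm_neg, hm]
  have hmn' : ∀ w ∈ fccSlots, ⟪G w, -m⟫_ℝ = 0 ∨ ⟪G w, -m⟫_ℝ = Real.sqrt (2 / 3) ∨ ⟪G w, -m⟫_ℝ = -Real.sqrt (2 / 3) := by
    intro w hw
    rcases hmn w hw with h0 | h0 | h0
    · exact Or.inl (by rw [inner_neg_right, h0, neg_zero])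
    · exact Or.inr (Or.inr (by rw [inner_neg_right, h0]))
    · exact Or.inr (Or.inl (by rw [inner_neg_right, h0, neg_neg]))
  have hr : 0 < Real.sqrt (2 / 3) := Real.sqrt_pos.2 (by norm_num)
  obtain ⟨a, ha, b, hb, c, hc, hna, hnb, hnc, hab, hac, hbc, -, -⟩ := exists_far_frame G hm' hmn'
  have neg_of : ∀ {w : EuclideanSpace ℝ (Fin 3)}, ⟪G w, -m⟫_ℝ = Real.sqrt (2 / 3) → ⟪G w, m⟫_ℝ ≤ 0 := by
    intro w hw; rw [inner_neg_right] at hw; linarith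
  exact frame_of_face_occupied_menu hmenu G ha hb hc hab hac hbc (hown a ha (neg_of hna)) (hown b hb (neg_of hnb))
    (hown c hc (neg_of hnc))

/-- **NARROW readings**: `IsNarrow X G d q` forces `G '' fccSlots ∈ {D₊, D₋}` (the positive face is occupied). -/
theorem frame_of_isNarrow_menu (hmenu : ∀ x ∈ X, dist q x = 1 →
      x - q ∈ fccSlots ∨ x - q ∈ (basalMirror : EuclideanSpace ℝ (Fin 3) → EuclideanSpace ℝ (Fin 3)) '' ↑fccSlots)
    {G : EuclideanSpace ℝ (Fin 3) ≃ₗᵢ[ℝ] EuclideanSpace ℝ (Fin 3)}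
    {d : EuclideanSpace ℝ (Fin 3)} (h : IsNarrow X G d q) :
    (G : EuclideanSpace ℝ (Fin 3) → EuclideanSpace ℝ (Fin 3)) '' ↑fccSlots = ↑fccSlots ∨
      (G : EuclideanSpace ℝ (Fin 3) → EuclideanSpace ℝ (Fin 3)) '' ↑fccSlots =
        (basalMirror : EuclideanSpace ℝ (Fin 3) → EuclideanSpace ℝ (Fin 3)) '' ↑fccSlots := by
  obtain ⟨-, m, ⟨hm, hmn⟩, -, hpos⟩ := h
  have hr : 0 < Real.sqrt (2 / 3) := Real.sqrt_pos.2 (by norm_num)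
  obtain ⟨a, ha, b, hb, c, hc, hna, hnb, hnc, hab, hac, hbc, -, -⟩ := exists_far_frame G hm hmn
  exact frame_of_face_occupied_menu hmenu G ha hb hc hab hac hbc (hpos a ha (by rw [hna]; exact hr))
    (hpos b hb (by rw [hnb]; exact hr)) (hpos c hc (by rw [hnc]; exact hr))

/-- **THE FRAME LEMMA for movers** under the neighbour menu: every mover clause of `IsEndMove X v G d q b` forces
`G '' fccSlots = D₊` or `= D₋`. -/
theorem frame_of_isEndMove_menu (hmenu : ∀ x ∈ X, dist q x = 1 →
      x - q ∈ fccSlots ∨ x - q ∈ (basalMirror : EuclideanSpace ℝ (Fin 3) → EuclideanSpace ℝ (Fin 3)) '' ↑fccSlots)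
    {v : WordVersion} {G : EuclideanSpace ℝ (Fin 3) ≃ₗᵢ[ℝ] EuclideanSpace ℝ (Fin 3)}
    {d b : EuclideanSpace ℝ (Fin 3)} (h : IsEndMove X v G d q b) :
    (G : EuclideanSpace ℝ (Fin 3) → EuclideanSpace ℝ (Fin 3)) '' ↑fccSlots = ↑fccSlots ∨
      (G : EuclideanSpace ℝ (Fin 3) → EuclideanSpace ℝ (Fin 3)) '' ↑fccSlots =
        (basalMirror : EuclideanSpace ℝ (Fin 3) → EuclideanSpace ℝ (Fin 3)) '' ↑fccSlots := by
  rcases h with ⟨hread, -, -⟩ | ⟨m, htr, -, -, -⟩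
  · rcases hread with hf | ⟨-, hn⟩ | ⟨m, htr, -⟩
    · exact frame_of_isFull_menu hmenu hf
    · exact frame_of_isNarrow_menu hmenu hn
    · exact frame_of_isTwinReading_menu hmenu htr
  · exact frame_of_isTwinReading_menu hmenu htr

/-- The same for a MOVING state `IsMoving X v G d q`. -/
theorem frame_of_isMoving_menu (hmenu : ∀ x ∈ X, dist q x = 1 →
      x - q ∈ fccSlots ∨ x - q ∈ (basalMirror : EuclideanSpace ℝ (Fin 3) → EuclideanSpace ℝ (Fin 3)) '' ↑fccSlots)
    {v : WordVersion} {G : EuclideanSpace ℝ (Fin 3) ≃ₗᵢ[ℝ] EuclideanSpace ℝ (Fin 3)}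
    {d : EuclideanSpace ℝ (Fin 3)} (h : IsMoving X v G d q) :
    (G : EuclideanSpace ℝ (Fin 3) → EuclideanSpace ℝ (Fin 3)) '' ↑fccSlots = ↑fccSlots ∨
      (G : EuclideanSpace ℝ (Fin 3) → EuclideanSpace ℝ (Fin 3)) '' ↑fccSlots =
        (basalMirror : EuclideanSpace ℝ (Fin 3) → EuclideanSpace ℝ (Fin 3)) '' ↑fccSlots := by
  rcases h with hf | ⟨m, htr, -⟩ | ⟨-, hn⟩
  · exact frame_of_isFull_menu hmenu hf
  · exact frame_of_isTwinReading_menu hmenu htr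
  · exact frame_of_isNarrow_menu hmenu hn

end Frame

end Summit.Ventures.Crystal3D.Theorems

end
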